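import Summits.QuantumFields.YangMills.Theorems.LuscherReductionTwistedTraceScalingTowerTargets
import Summits.QuantumFields.YangMills.Theorems.TwistedTraceScaling.Negative.FixedLatticeTraceLawFalseWithoutThreshold
import Summits.QuantumFields.YangMills.Theorems.TwistedTraceScaling.Negative.StrongCouplingBranch
import HarnessLib

/-!
# `TwistedTraceScaling` (crux stmt-QuantumFields-20203, route `LuscherReduction`, skeleton «twolattice» REV 2 «E1 COVERAGE»):
# negative-side support V — in the registered stub TOWER-E1 (`stub_towerE1`) BOTH coupling guards `1 ≤ β₁` (base) and `1 ≤ β`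
# (window, fine lattice) are load-bearing modulo S-BASE; the guard `2 ≤ M` is what makes the stub non-trivial
# (refuter crux-disprover seat, cycle 2; this file does NOT refute the crux or any stub)

HONEST FRAMING: `TwistedTraceScaling` is a femto-rung (R2b1) crux of a CONDITIONAL reduction route; nothing here is a mass-gap or
Clay statement.  Objects are the tree's (`TraceDoor.traceRatio/femtoSteps/hTraceRatio`, `InFemtoWindow`, `luscherLambda`,
`invRunningCoupling`).  TOWER-E1 is VERBATIM the hypothesis `hE1` of tree `Tower.twistedTraceScaling_of_towerE1_of_base`; S-BASE is
`Stmt.stub_fixedLatticeTraceLaw` (both spelled out below, no route import).  Mechanism (rev-2 analogue of support IV, which did this for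
the rev-1 all-pairs S-TOWER): the matching equation `1/ḡ²(β₁,b) = 1/ḡ²(β,L)` has, besides its weak root `β₁ ≥ 1`, a STRONG root
`0 < β₁ < 1`, `β₁ ≤ 2b₀e^{−(b₀/b₁)(1/lam³ − 1/2)}` (`exists_strong_matched`), where `traceRatio ≥ 1 − 4c_bβ₁T` (`one_sub_le_traceRatio`)
is as close to `1` as we please once `lam` is small — in TOWER-E1 the base range `[M, M²)` is fixed BEFORE `lam`, so neither `c_b` nor
`T ≤ (b+1)/lam` outgrows the superexponentially small root; the other side of the comparison is a fixed lattice at `β → ∞`, i.e. S-BASE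
content, kept as an explicit hypothesis.  Results (witness pair `(L, b, k) = (M², M, 0)`, `s = 1`, `ε = (1 − r_𝔥(1))/4`):
* `towerE1_false_without_beta1GeOne_of_base : S-BASE → ¬ (TOWER-E1 with «1 ≤ β₁ →» deleted)` (strong root on the base `M`);
* `towerE1_false_without_windowBetaGeOne_of_base : S-BASE → ¬ (TOWER-E1 with `InFemtoWindow lam β L` weakened to `lam ≤ Λ(β,L) ≤ 2lam`)`
  (strong root on the fine lattice `M²`);
* the same two facts for the RG-native text `LogRatioMatch-E1` (hypothesis `hLog` of tree `Tower.towerE1_of_logRatioMatchE1`);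
* `towerE1_without_twoLeM_trivial`: with the guard `2 ≤ M` deleted the TOWER-E1 text is PROVABLE (`M := 1`, empty base range).
Moral: any proof of TOWER-E1 must use `1 ≤ β₁` AND the window's `1 ≤ β` (they select the weak branch of the two-loop label on each
lattice); a planner must not weaken either, nor `2 ≤ M`.  Ordinary negative lemmas; no verdict on S-BASE or TOWER-E1 themselves.
-/

set_option autoImplicit false

noncomputable section

open MeasureTheory Filter Topology Real
open Literature.MathematicalPhysics.QuantumFieldTheory hiding SU2
open Literature.MathematicalPhysics.QuantumLattice
open scoped BigOperators

namespace Summit.QuantumFields.YangMills.Theorems.TwistedTraceScaling.Negative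

open Summit.QuantumFields.YangMills.Theorems.FemtoTransferGap
open Summit.QuantumFields.YangMills.Theorems.FemtoTransferGap.TraceDoor
open Summit.QuantumFields.YangMills.Theorems.FemtoTransferGap.TT
open Summit.QuantumFields.YangMills.Theorems.FemtoTransferGap.TwoLattice

namespace TowerE1

/-! ## §1 Witness kit: weak and strong roots of one label value, the strong-side bound, a logarithmic gap lemma -/

/-- The WEAK root: for `0 < lam ≤ 1` some `β ≥ 1` has label `1/ḡ²(β,L) = 1/lam³`, hence `Λ(β,L) = lam` and `(L, β)` lies in the window of
depth `lam`. [folklore] -/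
theorem weak_root (L : ℕ) [NeZero L] {lam : ℝ} (h0 : 0 < lam) (h1 : lam ≤ 1) :
    ∃ β : ℝ, 1 ≤ β ∧ invRunningCoupling β L = 1 / lam ^ 3 ∧ luscherLambda β L = lam ∧ InFemtoWindow lam β L := by
  have hv : (1 : ℝ) ≤ 1 / lam ^ 3 := by
    rw [le_div_iff₀ (by positivity)]; linarith [pow_le_one₀ (n := 3) h0.le h1]
  obtain ⟨β, hβ1, hval⟩ := Tower.exists_matched L hv
  have hvpos : 0 < invRunningCoupling β L := by rw [hval]; positivity
  have h3 : luscherLambda β L ^ 3 = lam ^ 3 := by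
    rw [BOHandover.luscherLambda_pow_three hvpos, hval, one_div, inv_inv]
  have hnn : 0 ≤ luscherLambda β L := by
    unfold luscherLambda; exact Real.rpow_nonneg (le_max_right _ _) _
  have hΛ : luscherLambda β L = lam := (pow_left_inj₀ hnn h0.le (by norm_num : (3 : ℕ) ≠ 0)).1 h3
  exact ⟨β, hβ1, hval, hΛ, hβ1, by rw [hΛ], by rw [hΛ]; linarith⟩

/-- The STRONG root of the same label value: some `0 < β₁ < 1`, `β₁ ≤ 2b₀e^{−(b₀/b₁)(1/lam³ − 1/2)}`, with `1/ḡ²(β₁,b) = 1/lam³` and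
`Λ(β₁,b) = lam`. [folklore] -/
theorem strong_root (b : ℕ) [NeZero b] {lam : ℝ} (h0 : 0 < lam) (h1 : lam ≤ 1) :
    ∃ β₁ : ℝ, 0 < β₁ ∧ β₁ < 1 ∧ β₁ ≤ 2 * b0 * Real.exp (-(b0 / b1) * (1 / lam ^ 3 - 1 / 2)) ∧
      invRunningCoupling β₁ b = 1 / lam ^ 3 ∧ luscherLambda β₁ b = lam := by
  have hv : (1 : ℝ) ≤ 1 / lam ^ 3 := by
    rw [le_div_iff₀ (by positivity)]; linarith [pow_le_one₀ (n := 3) h0.le h1]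
  obtain ⟨β, hβ0, hβ1, hβle, hval⟩ := exists_strong_matched b hv
  have hvpos : 0 < invRunningCoupling β b := by rw [hval]; positivity
  have h3 : luscherLambda β b ^ 3 = lam ^ 3 := by
    rw [BOHandover.luscherLambda_pow_three hvpos, hval, one_div, inv_inv]
  have hnn : 0 ≤ luscherLambda β b := by
    unfold luscherLambda; exact Real.rpow_nonneg (le_max_right _ _) _
  exact ⟨β, hβ0, hβ1, hβle, hval, (pow_left_inj₀ hnn h0.le (by norm_num : (3 : ℕ) ≠ 0)).1 h3⟩

/-- Step count at `s = 1` when `Λ(β,L) = lam ≤ 1/2`: `2 ≤ T = ⌈L/lam⌉ ≤ (L+1)/lam`. [folklore] -/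
theorem femtoSteps_bounds (L : ℕ) [NeZero L] {lam β : ℝ} (h0 : 0 < lam) (hhalf : lam ≤ 1 / 2)
    (hΛ : luscherLambda β L = lam) :
    2 ≤ femtoSteps 1 β L ∧ (femtoSteps 1 β L : ℝ) ≤ ((L : ℝ) + 1) / lam := by
  have hL1 : (1 : ℝ) ≤ (L : ℝ) := by exact_mod_cast NeZero.one_le
  unfold femtoSteps
  rw [hΛ]
  constructor
  · have hx : (1 : ℝ) < 1 * (L : ℝ) / lam := by
      rw [lt_div_iff₀ h0]; nlinarith
    have := Nat.lt_ceil.mpr (by exact_mod_cast hx : ((1 : ℕ) : ℝ) < 1 * (L : ℝ) / lam)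
    omega
  · have h1 : (⌈1 * (L : ℝ) / lam⌉₊ : ℝ) < 1 * (L : ℝ) / lam + 1 := Nat.ceil_lt_add_one (by positivity)
    have h2 : (1 : ℝ) ≤ 1 / lam := by rw [le_div_iff₀ h0]; linarith
    have h3 : ((L : ℝ) + 1) / lam = 1 * (L : ℝ) / lam + 1 / lam := by ring
    linarith

/-- **Strong-side bound**: on a FIXED lattice `Lb`, for `lam` small enough, a coupling `β₁ ≤ 2b₀e^{−(b₀/b₁)(1/lam³ − 1/2)}` and a step count
`T ≤ (Lb+1)/lam` give `traceRatio Lb β₁ T ≥ 1 − g/4` (`1 − 4c_{Lb}β₁T ≤ r` and `e^{−κ/lam³} ≤ lam³/κ`). [folklore] -/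
theorem strong_side_ge (Lb : ℕ) [NeZero Lb] {g : ℝ} (hg : 0 < g) :
    ∃ lam1 : ℝ, 0 < lam1 ∧ lam1 ≤ 1 / 4 ∧ ∀ lam : ℝ, 0 < lam → lam ≤ lam1 →
      ∀ β₁ : ℝ, 0 ≤ β₁ → β₁ ≤ 2 * b0 * Real.exp (-(b0 / b1) * (1 / lam ^ 3 - 1 / 2)) →
        ∀ T : ℕ, 1 ≤ T → (T : ℝ) ≤ ((Lb : ℝ) + 1) / lam → 1 - g / 4 ≤ traceRatio Lb β₁ T := by
  have hb0 : 0 < b0 := by unfold b0; positivity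
  have hb1 : 0 < b1 := by unfold b1; positivity
  obtain ⟨c, hc⟩ : ∃ c : ℝ,
      c = 2 * (Fintype.card (Edge 3 Lb) : ℝ) + 4 * (Fintype.card (Plaquette 3 Lb) : ℝ) := ⟨_, rfl⟩
  have hcnn : 0 ≤ c := by rw [hc]; positivity
  obtain ⟨κ, hκ⟩ : ∃ κ : ℝ, κ = b0 / b1 := ⟨_, rfl⟩
  have hκ0 : 0 < κ := by rw [hκ]; exact div_pos hb0 hb1
  obtain ⟨N, hN⟩ : ∃ N : ℝ, N = (Lb : ℝ) + 1 := ⟨_, rfl⟩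
  have hN0 : 0 < N := by rw [hN]; positivity
  obtain ⟨C, hC⟩ : ∃ C : ℝ, C = 8 * c * b0 * Real.exp (κ / 2) * N / κ + 1 := ⟨_, rfl⟩
  have hC0 : 0 < C := by rw [hC]; positivity
  refine ⟨min (1 / 4) (g / (4 * C)), lt_min (by norm_num) (by positivity), min_le_left _ _, ?_⟩
  intro lam hlam_pos hlam_le β₁ hβ₁0 hβ₁le T hT1 hTle
  have hlam_q : lam ≤ 1 / 4 := hlam_le.trans (min_le_left _ _)
  have hlam_g : lam ≤ g / (4 * C) := hlam_le.trans (min_le_right _ _)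
  have hlam_one : lam ≤ 1 := by linarith
  have hlow := one_sub_le_traceRatio Lb hβ₁0 hT1
  rw [← hc] at hlow
  rw [← hN] at hTle
  have hsmall : 4 * (c * β₁) * T ≤ g / 4 := by
    have he : Real.exp (-(b0 / b1) * (1 / lam ^ 3 - 1 / 2)) = Real.exp (κ / 2) * Real.exp (-(κ / lam ^ 3)) := by
      rw [← Real.exp_add, hκ]; congr 1; ring
    have hx : 0 < κ / lam ^ 3 := by positivity
    have hex : Real.exp (-(κ / lam ^ 3)) ≤ lam ^ 3 / κ := by
      have h1 : κ / lam ^ 3 + 1 ≤ Real.exp (κ / lam ^ 3) := Real.add_one_le_exp _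
      rw [Real.exp_neg]
      calc (Real.exp (κ / lam ^ 3))⁻¹ ≤ (κ / lam ^ 3)⁻¹ := inv_anti₀ hx (by linarith)
        _ = lam ^ 3 / κ := by rw [inv_div]
    have hβ' : β₁ ≤ 2 * b0 * Real.exp (κ / 2) * (lam ^ 3 / κ) := by
      calc β₁ ≤ 2 * b0 * Real.exp (-(b0 / b1) * (1 / lam ^ 3 - 1 / 2)) := hβ₁le
        _ = 2 * b0 * Real.exp (κ / 2) * Real.exp (-(κ / lam ^ 3)) := by rw [he]; ring
        _ ≤ 2 * b0 * Real.exp (κ / 2) * (lam ^ 3 / κ) := mul_le_mul_of_nonneg_left hex (by positivity)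
    have hE0 : 0 < Real.exp (κ / 2) := Real.exp_pos _
    calc 4 * (c * β₁) * T ≤ 4 * (c * (2 * b0 * Real.exp (κ / 2) * (lam ^ 3 / κ))) * (N / lam) := by
          apply mul_le_mul _ hTle (by positivity) (by positivity)
          exact mul_le_mul_of_nonneg_left (mul_le_mul_of_nonneg_left hβ' hcnn) (by norm_num)
      _ = (8 * c * b0 * Real.exp (κ / 2) * N / κ) * lam ^ 2 := by field_simp; ring
      _ ≤ C * lam ^ 2 := by
          apply mul_le_mul_of_nonneg_right _ (by positivity)
          rw [hC]; linarith
      _ ≤ C * lam := mul_le_mul_of_nonneg_left (by nlinarith) hC0.le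
      _ ≤ C * (g / (4 * C)) := mul_le_mul_of_nonneg_left hlam_g hC0.le
      _ = g / 4 := by field_simp
  linarith

/-- **Logarithmic gap**: if `0 < x ≤ 1 − 3a` and `y ≥ 1 − a` (`0 < a ≤ 1/4`) then `|log x − log y| > a`
(`log((1−a)/(1−3a)) ≥ 2a/(1−a) ≥ 2a`). [folklore] -/
theorem log_gap {a x y : ℝ} (ha : 0 < a) (ha4 : a ≤ 1 / 4) (hx : 0 < x) (hxle : x ≤ 1 - 3 * a) (hy : 1 - a ≤ y) :
    a < |Real.log x - Real.log y| := by
  have h3a : 0 < 1 - 3 * a := by linarith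
  have h1a : 0 < 1 - a := by linarith
  have hy0 : 0 < y := lt_of_lt_of_le h1a hy
  have h1 : Real.log x ≤ Real.log (1 - 3 * a) := Real.log_le_log hx hxle
  have h2 : Real.log (1 - a) ≤ Real.log y := Real.log_le_log h1a hy
  have h4 : Real.log ((1 - 3 * a) / (1 - a)) = Real.log (1 - 3 * a) - Real.log (1 - a) :=
    Real.log_div h3a.ne' h1a.ne'
  have h5 : Real.log ((1 - 3 * a) / (1 - a)) ≤ (1 - 3 * a) / (1 - a) - 1 :=
    Real.log_le_sub_one_of_pos (div_pos h3a h1a)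
  have h6 : (1 - 3 * a) / (1 - a) - 1 = -(2 * a / (1 - a)) := by field_simp; ring
  have h7 : 2 * a ≤ 2 * a / (1 - a) := by rw [le_div_iff₀ h1a]; nlinarith
  have h8 : 2 * a ≤ Real.log y - Real.log x := by linarith
  rw [abs_sub_comm]
  exact lt_of_lt_of_le (by linarith) (le_abs_self _)

/-- Threshold bookkeeping: a window coupling at depth `lam ≤ 1/2`, `lam ≤ 1/Mt` exceeds any `βthr ≤ Mt`
(`β ≥ 1/(4lam³) ≥ 1/lam ≥ Mt`). [folklore] -/
theorem thr_le_of_window {lam β βthr Mt : ℝ} {L : ℕ} [NeZero L] (hlam : 0 < lam) (hhalf : lam ≤ 1 / 2)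
    (hM0 : 0 < Mt) (hMB : βthr ≤ Mt) (hlamM : lam ≤ 1 / Mt) (hW : InFemtoWindow lam β L) : βthr ≤ β := by
  have h1 : 1 / (4 * lam ^ 3) ≤ β := BOHandover.beta_ge_of_window hlam hW
  have h2 : Mt ≤ 1 / lam := by
    rw [le_div_iff₀ hlam]
    calc Mt * lam ≤ Mt * (1 / Mt) := mul_le_mul_of_nonneg_left hlamM hM0.le
      _ = 1 := by field_simp
  have h3 : 1 / lam ≤ 1 / (4 * lam ^ 3) := by
    rw [div_le_div_iff₀ hlam (by positivity)]
    have h4 : lam ^ 2 ≤ 1 / 4 := by nlinarith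
    nlinarith
  linarith

/-! ## §2 The two witness packages (S-BASE consumed once each, on the weak-root side) -/

/-- **Witness, strong root on the BASE.**  Given S-BASE, for any fine lattice `L`, any base `b` and any `lam0 > 0` there are a depth
`0 < lam ≤ lam0`, a window coupling `β` on `L` and a STRONG matched coupling `β₁ < 1` on `b` with `r(b,β₁,T_b) ≥ 1 − g/4`,
`r(L,β,T_L) ≤ r_𝔥(1) + g/4` and `r(L,β,T_L) > 0`, where `g = 1 − r_𝔥(1) > 0`, `s = 1`. [folklore] -/
theorem witness_strongBase
    (hBASE : ∀ (L1 : ℕ) [NeZero L1] (s : ℝ), 0 < s → ∀ ε : ℝ, 0 < ε → ∃ β1 : ℝ, ∀ β : ℝ, β1 ≤ β →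
      |traceRatio L1 β (femtoSteps s β L1) - hTraceRatio s| ≤ ε)
    (L b : ℕ) [NeZero L] [NeZero b] {lam0 : ℝ} (hlam0 : 0 < lam0) :
    ∃ lam β β₁ : ℝ, 0 < lam ∧ lam ≤ lam0 ∧ InFemtoWindow lam β L ∧
      invRunningCoupling β₁ b = invRunningCoupling β L ∧
      1 - (1 - hTraceRatio 1) / 4 ≤ traceRatio b β₁ (femtoSteps 1 β₁ b) ∧
      traceRatio L β (femtoSteps 1 β L) ≤ hTraceRatio 1 + (1 - hTraceRatio 1) / 4 ∧
      0 < traceRatio L β (femtoSteps 1 β L) := by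
  have hr1 : hTraceRatio 1 < 1 := hTraceRatio_lt_one one_pos
  obtain ⟨g, hg⟩ : ∃ g : ℝ, g = 1 - hTraceRatio 1 := ⟨_, rfl⟩
  have hg0 : 0 < g := by rw [hg]; linarith
  rw [← hg]
  obtain ⟨lam1, hlam1, hlam1q, HS⟩ := strong_side_ge b hg0
  obtain ⟨βthr, hB⟩ := hBASE L 1 one_pos (g / 4) (by positivity)
  obtain ⟨Mt, hMt⟩ : ∃ Mt : ℝ, Mt = max βthr 1 := ⟨_, rfl⟩
  have hM1 : 1 ≤ Mt := by rw [hMt]; exact le_max_right _ _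
  have hMB : βthr ≤ Mt := by rw [hMt]; exact le_max_left _ _
  have hM0 : 0 < Mt := by linarith
  obtain ⟨lam, hlam_pos, hlam_le0, hlam_le1, hlam_M⟩ :
      ∃ lam : ℝ, 0 < lam ∧ lam ≤ lam0 ∧ lam ≤ lam1 ∧ lam ≤ 1 / Mt :=
    ⟨min lam0 (min lam1 (1 / Mt)), lt_min hlam0 (lt_min hlam1 (by positivity)), min_le_left _ _,
      (min_le_right _ _).trans (min_le_left _ _), (min_le_right _ _).trans (min_le_right _ _)⟩
  have hlam_half : lam ≤ 1 / 2 := by linarith [hlam_le1.trans hlam1q]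
  have hlam_one : lam ≤ 1 := by linarith
  obtain ⟨β, hβ1, hval, hΛ, hW⟩ := weak_root L hlam_pos hlam_one
  obtain ⟨β₁, hβ₁0, -, hβ₁le, hval₁, hΛ₁⟩ := strong_root b hlam_pos hlam_one
  have hmatch : invRunningCoupling β₁ b = invRunningCoupling β L := by rw [hval₁, hval]
  obtain ⟨hT2, _⟩ := femtoSteps_bounds L hlam_pos hlam_half hΛ
  obtain ⟨hT2₁, hTle₁⟩ := femtoSteps_bounds b hlam_pos hlam_half hΛ₁
  -- strong side on the base
  have hlow := HS lam hlam_pos hlam_le1 β₁ hβ₁0.le hβ₁le (femtoSteps 1 β₁ b) (by omega) hTle₁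
  -- S-BASE on the fine lattice at the weak root: `β ≥ 1/(4lam³) ≥ βthr`
  have hβ_large : βthr ≤ β := thr_le_of_window hlam_pos hlam_half hM0 hMB hlam_M hW
  have hBw := hB β hβ_large
  have hup : traceRatio L β (femtoSteps 1 β L) ≤ hTraceRatio 1 + g / 4 := by linarith [(abs_le.mp hBw).2]
  have hpos := (Tower.traceRatio_mem L hβ1 hT2).1
  exact ⟨lam, β, β₁, hlam_pos, hlam_le0, hW, hmatch, hlow, hup, hpos⟩

/-- **Witness, strong root on the FINE lattice.**  Given S-BASE, for any `L`, `b`, `lam0 > 0` there are `0 < lam ≤ lam0`, a STRONG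
coupling `β < 1` on `L` meeting the window inequalities `lam ≤ Λ(β,L) ≤ 2lam`, and a weak matched `β₁ ≥ 1` on `b` with
`r(L,β,T_L) ≥ 1 − g/4`, `r(b,β₁,T_b) ≤ r_𝔥(1) + g/4`, `r(b,β₁,T_b) > 0` (`g = 1 − r_𝔥(1)`, `s = 1`). [folklore] -/
theorem witness_strongFine
    (hBASE : ∀ (L1 : ℕ) [NeZero L1] (s : ℝ), 0 < s → ∀ ε : ℝ, 0 < ε → ∃ β1 : ℝ, ∀ β : ℝ, β1 ≤ β →
      |traceRatio L1 β (femtoSteps s β L1) - hTraceRatio s| ≤ ε)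
    (L b : ℕ) [NeZero L] [NeZero b] {lam0 : ℝ} (hlam0 : 0 < lam0) :
    ∃ lam β β₁ : ℝ, 0 < lam ∧ lam ≤ lam0 ∧ lam ≤ luscherLambda β L ∧ luscherLambda β L ≤ 2 * lam ∧ 1 ≤ β₁ ∧
      invRunningCoupling β₁ b = invRunningCoupling β L ∧
      1 - (1 - hTraceRatio 1) / 4 ≤ traceRatio L β (femtoSteps 1 β L) ∧
      traceRatio b β₁ (femtoSteps 1 β₁ b) ≤ hTraceRatio 1 + (1 - hTraceRatio 1) / 4 ∧
      0 < traceRatio b β₁ (femtoSteps 1 β₁ b) := by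
  have hr1 : hTraceRatio 1 < 1 := hTraceRatio_lt_one one_pos
  obtain ⟨g, hg⟩ : ∃ g : ℝ, g = 1 - hTraceRatio 1 := ⟨_, rfl⟩
  have hg0 : 0 < g := by rw [hg]; linarith
  rw [← hg]
  obtain ⟨lam1, hlam1, hlam1q, HS⟩ := strong_side_ge L hg0
  obtain ⟨βthr, hB⟩ := hBASE b 1 one_pos (g / 4) (by positivity)
  obtain ⟨Mt, hMt⟩ : ∃ Mt : ℝ, Mt = max βthr 1 := ⟨_, rfl⟩
  have hM1 : 1 ≤ Mt := by rw [hMt]; exact le_max_right _ _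
  have hMB : βthr ≤ Mt := by rw [hMt]; exact le_max_left _ _
  have hM0 : 0 < Mt := by linarith
  obtain ⟨lam, hlam_pos, hlam_le0, hlam_le1, hlam_M⟩ :
      ∃ lam : ℝ, 0 < lam ∧ lam ≤ lam0 ∧ lam ≤ lam1 ∧ lam ≤ 1 / Mt :=
    ⟨min lam0 (min lam1 (1 / Mt)), lt_min hlam0 (lt_min hlam1 (by positivity)), min_le_left _ _,
      (min_le_right _ _).trans (min_le_left _ _), (min_le_right _ _).trans (min_le_right _ _)⟩
  have hlam_half : lam ≤ 1 / 2 := by linarith [hlam_le1.trans hlam1q]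
  have hlam_one : lam ≤ 1 := by linarith
  obtain ⟨β, hβ0, -, hβle, hval, hΛ⟩ := strong_root L hlam_pos hlam_one
  obtain ⟨β₁, hβ₁1, hval₁, hΛ₁, hW₁⟩ := weak_root b hlam_pos hlam_one
  have hmatch : invRunningCoupling β₁ b = invRunningCoupling β L := by rw [hval₁, hval]
  obtain ⟨hT2, hTle⟩ := femtoSteps_bounds L hlam_pos hlam_half hΛ
  obtain ⟨hT2₁, _⟩ := femtoSteps_bounds b hlam_pos hlam_half hΛ₁
  have hT1 : 1 ≤ femtoSteps 1 β L := by omega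
  -- strong side on the fine lattice
  have hlow := HS lam hlam_pos hlam_le1 β hβ0.le hβle (femtoSteps 1 β L) hT1 hTle
  -- S-BASE on the base at the weak root
  have hβ₁_large : βthr ≤ β₁ := thr_le_of_window hlam_pos hlam_half hM0 hMB hlam_M hW₁
  have hBw := hB β₁ hβ₁_large
  have hup : traceRatio b β₁ (femtoSteps 1 β₁ b) ≤ hTraceRatio 1 + g / 4 := by linarith [(abs_le.mp hBw).2]
  have hpos := (Tower.traceRatio_mem b hβ₁1 hT2₁).1
  exact ⟨lam, β, β₁, hlam_pos, hlam_le0, by rw [hΛ], by rw [hΛ]; linarith, hβ₁1, hmatch, hlow, hup, hpos⟩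

/-- E1 arithmetic of the witness pair `(L, b, k) = (M², M, 0)`: all four pair constraints hold for `M ≥ 2`. [folklore] -/
theorem pair_MSq (M : ℕ) (hM : 2 ≤ M) :
    M ≤ M ∧ M < M ^ 2 ∧ M * M ^ (0 + 1) ≤ M ^ 2 ∧ M ^ 2 < M * M ^ 0 * (M + 1) := by
  refine ⟨le_rfl, by nlinarith, le_of_eq (by ring), ?_⟩
  rw [pow_zero, mul_one]
  nlinarith

end TowerE1

/-! ## §3 TOWER-E1: the base guard `1 ≤ β₁` is load-bearing (modulo S-BASE) -/

/-- **TOWER-E1 without `1 ≤ β₁` is false, given S-BASE.**  Hypothesis = `Stmt.stub_fixedLatticeTraceLaw` verbatim; negated conclusion =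
`Stmt.stub_towerE1` verbatim with the binder `1 ≤ β₁ →` deleted.  Witness: `s = 1`, `ε = (1 − r_𝔥(1))/4`, `L = M²`, `b = M`, `k = 0`,
`β` the weak root on `M²` and `β₁` the strong root on `M` of the label value `1/lam³`. [folklore] -/
theorem towerE1_false_without_beta1GeOne_of_base
    (hBASE : ∀ (L1 : ℕ) [NeZero L1] (s : ℝ), 0 < s → ∀ ε : ℝ, 0 < ε → ∃ β1 : ℝ, ∀ β : ℝ, β1 ≤ β →
      |traceRatio L1 β (femtoSteps s β L1) - hTraceRatio s| ≤ ε) :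
    ¬ (∀ s : ℝ, 0 < s → ∀ ε : ℝ, 0 < ε → ∃ M : ℕ, 2 ≤ M ∧ ∃ lam0 : ℝ, 0 < lam0 ∧ ∀ lam : ℝ, 0 < lam → lam ≤ lam0 →
        ∀ (L : ℕ) [NeZero L], M ^ 2 ≤ L → ∀ β : ℝ, InFemtoWindow lam β L →
          ∀ (b k : ℕ) [NeZero b], M ≤ b → b < M ^ 2 → b * M ^ (k + 1) ≤ L → L < b * M ^ k * (M + 1) →
            ∀ β₁ : ℝ, invRunningCoupling β₁ b = invRunningCoupling β L →
              |traceRatio L β (femtoSteps s β L) - traceRatio b β₁ (femtoSteps s β₁ b)| ≤ ε) := by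
  intro h
  have hr1 : hTraceRatio 1 < 1 := hTraceRatio_lt_one one_pos
  obtain ⟨M, hM, lam0, hlam0, H⟩ := h 1 one_pos ((1 - hTraceRatio 1) / 4) (by linarith)
  haveI : NeZero M := ⟨by omega⟩
  haveI : NeZero (M ^ 2) := ⟨pow_ne_zero 2 (by omega)⟩
  obtain ⟨lam, β, β₁, hlam, hle, hW, hmatch, hlow, hup, -⟩ := TowerE1.witness_strongBase hBASE (M ^ 2) M hlam0
  obtain ⟨c1, c2, c3, c4⟩ := TowerE1.pair_MSq M hM
  have hH := H lam hlam hle (M ^ 2) le_rfl β hW M 0 c1 c2 c3 c4 β₁ hmatch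
  have h1 := (abs_le.mp hH).1
  linarith

/-! ## §4 TOWER-E1: the window guard `1 ≤ β` (fine lattice) is load-bearing (modulo S-BASE) -/

/-- **TOWER-E1 without the window's `1 ≤ β` is false, given S-BASE.**  Negated conclusion = `Stmt.stub_towerE1` with
`InFemtoWindow lam β L` weakened to its two `Λ`-inequalities.  Witness: `L = M²` at the STRONG root, `b = M` at the weak root `β₁ ≥ 1`,
`k = 0`, `s = 1`, `ε = (1 − r_𝔥(1))/4`. [folklore] -/
theorem towerE1_false_without_windowBetaGeOne_of_base
    (hBASE : ∀ (L1 : ℕ) [NeZero L1] (s : ℝ), 0 < s → ∀ ε : ℝ, 0 < ε → ∃ β1 : ℝ, ∀ β : ℝ, β1 ≤ β →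
      |traceRatio L1 β (femtoSteps s β L1) - hTraceRatio s| ≤ ε) :
    ¬ (∀ s : ℝ, 0 < s → ∀ ε : ℝ, 0 < ε → ∃ M : ℕ, 2 ≤ M ∧ ∃ lam0 : ℝ, 0 < lam0 ∧ ∀ lam : ℝ, 0 < lam → lam ≤ lam0 →
        ∀ (L : ℕ) [NeZero L], M ^ 2 ≤ L → ∀ β : ℝ, lam ≤ luscherLambda β L → luscherLambda β L ≤ 2 * lam →
          ∀ (b k : ℕ) [NeZero b], M ≤ b → b < M ^ 2 → b * M ^ (k + 1) ≤ L → L < b * M ^ k * (M + 1) →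
            ∀ β₁ : ℝ, 1 ≤ β₁ → invRunningCoupling β₁ b = invRunningCoupling β L →
              |traceRatio L β (femtoSteps s β L) - traceRatio b β₁ (femtoSteps s β₁ b)| ≤ ε) := by
  intro h
  have hr1 : hTraceRatio 1 < 1 := hTraceRatio_lt_one one_pos
  obtain ⟨M, hM, lam0, hlam0, H⟩ := h 1 one_pos ((1 - hTraceRatio 1) / 4) (by linarith)
  haveI : NeZero M := ⟨by omega⟩
  haveI : NeZero (M ^ 2) := ⟨pow_ne_zero 2 (by omega)⟩
  obtain ⟨lam, β, β₁, hlam, hle, hlo, hhi, hβ₁1, hmatch, hlow, hup, -⟩ :=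
    TowerE1.witness_strongFine hBASE (M ^ 2) M hlam0
  obtain ⟨c1, c2, c3, c4⟩ := TowerE1.pair_MSq M hM
  have hH := H lam hlam hle (M ^ 2) le_rfl β hlo hhi M 0 c1 c2 c3 c4 β₁ hβ₁1 hmatch
  have h1 := (abs_le.mp hH).2
  linarith

/-! ## §5 The same two guards in the RG-native text `LogRatioMatch-E1` -/

/-- **LogRatioMatch-E1 without `1 ≤ β₁` is false, given S-BASE** (hypothesis `hLog` of tree `Tower.towerE1_of_logRatioMatchE1` with the binder
`1 ≤ β₁ →` deleted; same witness as §3; `|log r_L − log r_b| ≥ log((1−a)/(1−3a)) ≥ 2a > a = ε`). [folklore] -/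
theorem logRatioMatchE1_false_without_beta1GeOne_of_base
    (hBASE : ∀ (L1 : ℕ) [NeZero L1] (s : ℝ), 0 < s → ∀ ε : ℝ, 0 < ε → ∃ β1 : ℝ, ∀ β : ℝ, β1 ≤ β →
      |traceRatio L1 β (femtoSteps s β L1) - hTraceRatio s| ≤ ε) :
    ¬ (∀ s : ℝ, 0 < s → ∀ ε : ℝ, 0 < ε → ∃ M : ℕ, 2 ≤ M ∧ ∃ lam0 : ℝ, 0 < lam0 ∧ ∀ lam : ℝ, 0 < lam → lam ≤ lam0 →
        ∀ (L : ℕ) [NeZero L], M ^ 2 ≤ L → ∀ β : ℝ, InFemtoWindow lam β L →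
          ∀ (b k : ℕ) [NeZero b], M ≤ b → b < M ^ 2 → b * M ^ (k + 1) ≤ L → L < b * M ^ k * (M + 1) →
            ∀ β₁ : ℝ, invRunningCoupling β₁ b = invRunningCoupling β L →
              |Real.log (traceRatio L β (femtoSteps s β L)) - Real.log (traceRatio b β₁ (femtoSteps s β₁ b))| ≤ ε) := by
  intro h
  have hr1 : hTraceRatio 1 < 1 := hTraceRatio_lt_one one_pos
  have hr0 : 0 < hTraceRatio 1 := hTraceRatio_pos one_pos
  obtain ⟨M, hM, lam0, hlam0, H⟩ := h 1 one_pos ((1 - hTraceRatio 1) / 4) (by linarith)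
  haveI : NeZero M := ⟨by omega⟩
  haveI : NeZero (M ^ 2) := ⟨pow_ne_zero 2 (by omega)⟩
  obtain ⟨lam, β, β₁, hlam, hle, hW, hmatch, hlow, hup, hpos⟩ := TowerE1.witness_strongBase hBASE (M ^ 2) M hlam0
  obtain ⟨c1, c2, c3, c4⟩ := TowerE1.pair_MSq M hM
  have hH := H lam hlam hle (M ^ 2) le_rfl β hW M 0 c1 c2 c3 c4 β₁ hmatch
  have hgap := TowerE1.log_gap (a := (1 - hTraceRatio 1) / 4) (by linarith) (by linarith) hpos (by linarith) hlow
  linarith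

/-- **LogRatioMatch-E1 without the window's `1 ≤ β` is false, given S-BASE** (same witness as §4). [folklore] -/
theorem logRatioMatchE1_false_without_windowBetaGeOne_of_base
    (hBASE : ∀ (L1 : ℕ) [NeZero L1] (s : ℝ), 0 < s → ∀ ε : ℝ, 0 < ε → ∃ β1 : ℝ, ∀ β : ℝ, β1 ≤ β →
      |traceRatio L1 β (femtoSteps s β L1) - hTraceRatio s| ≤ ε) :
    ¬ (∀ s : ℝ, 0 < s → ∀ ε : ℝ, 0 < ε → ∃ M : ℕ, 2 ≤ M ∧ ∃ lam0 : ℝ, 0 < lam0 ∧ ∀ lam : ℝ, 0 < lam → lam ≤ lam0 →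
        ∀ (L : ℕ) [NeZero L], M ^ 2 ≤ L → ∀ β : ℝ, lam ≤ luscherLambda β L → luscherLambda β L ≤ 2 * lam →
          ∀ (b k : ℕ) [NeZero b], M ≤ b → b < M ^ 2 → b * M ^ (k + 1) ≤ L → L < b * M ^ k * (M + 1) →
            ∀ β₁ : ℝ, 1 ≤ β₁ → invRunningCoupling β₁ b = invRunningCoupling β L →
              |Real.log (traceRatio L β (femtoSteps s β L)) - Real.log (traceRatio b β₁ (femtoSteps s β₁ b))| ≤ ε) := by
  intro h
  have hr1 : hTraceRatio 1 < 1 := hTraceRatio_lt_one one_pos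
  have hr0 : 0 < hTraceRatio 1 := hTraceRatio_pos one_pos
  obtain ⟨M, hM, lam0, hlam0, H⟩ := h 1 one_pos ((1 - hTraceRatio 1) / 4) (by linarith)
  haveI : NeZero M := ⟨by omega⟩
  haveI : NeZero (M ^ 2) := ⟨pow_ne_zero 2 (by omega)⟩
  obtain ⟨lam, β, β₁, hlam, hle, hlo, hhi, hβ₁1, hmatch, hlow, hup, hpos⟩ :=
    TowerE1.witness_strongFine hBASE (M ^ 2) M hlam0
  obtain ⟨c1, c2, c3, c4⟩ := TowerE1.pair_MSq M hM
  have hH := H lam hlam hle (M ^ 2) le_rfl β hlo hhi M 0 c1 c2 c3 c4 β₁ hβ₁1 hmatch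
  have hgap := TowerE1.log_gap (a := (1 - hTraceRatio 1) / 4) (by linarith) (by linarith) hpos (by linarith) hlow
  rw [abs_sub_comm] at hgap
  linarith

/-! ## §6 The guard `2 ≤ M` is what makes TOWER-E1 non-trivial -/

/-- **Without `2 ≤ M` the TOWER-E1 text is provable outright**: `M := 1` makes the base range `M ≤ b < M²` EMPTY, so the body is
vacuously true — information for planners: the guard (consumed by `Tower.exists_tower_landing`) must not be weakened. [folklore] -/
theorem towerE1_without_twoLeM_trivial :
    ∀ s : ℝ, 0 < s → ∀ ε : ℝ, 0 < ε → ∃ M : ℕ, ∃ lam0 : ℝ, 0 < lam0 ∧ ∀ lam : ℝ, 0 < lam → lam ≤ lam0 →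
      ∀ (L : ℕ) [NeZero L], M ^ 2 ≤ L → ∀ β : ℝ, InFemtoWindow lam β L →
        ∀ (b k : ℕ) [NeZero b], M ≤ b → b < M ^ 2 → b * M ^ (k + 1) ≤ L → L < b * M ^ k * (M + 1) →
          ∀ β₁ : ℝ, 1 ≤ β₁ → invRunningCoupling β₁ b = invRunningCoupling β L →
            |traceRatio L β (femtoSteps s β L) - traceRatio b β₁ (femtoSteps s β₁ b)| ≤ ε := by
  intro s _ ε _
  refine ⟨1, 1, one_pos, ?_⟩
  intro lam _ _ L _ _ β _ b k _ hb1 hb2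
  exfalso
  rw [one_pow] at hb2
  omega

end Summit.QuantumFields.YangMills.Theorems.TwistedTraceScaling.Negative

end
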